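import Mathlib
import Literature.Analysis.FluidPDE.SelfSimilar
import Literature.Analysis.FluidPDE.AncientMildWeak
import Literature.Analysis.FluidPDE.BoundedWeakIsometry
import Literature.Analysis.FluidPDE.KNSSTypeIRateLiouvilleDescent
import Literature.Analysis.FluidPDE.KNSSTypeIRateLiouvilleMild
import Literature.Analysis.FluidPDE.KNSSLiouvillePlanarHolds
import Literature.Analysis.FluidPDE.NSBoundedMildOseenClassical
import Summits.NavierStokesRegularity.NavierStokesRegularity.Theorems.ClockStretchingLawClockCeilingStubSliceInvariantOfCurlParallel
import HarnessLib

/-!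
# Route ContinuousAlignment, crux `ContinuousAlignmentCriterion` (stmt-NavierStokesRegularity-18584),
# lines `birth` / `pace`, stub `stub_unidirectionalLiouville`: the rate-free unidirectional Liouville theorem

What is proved (`stub_unidirectionalLiouville`, registered stub of both lines; verbatim the shared
support item `stmt-NavierStokesRegularity-1923` of route DirectionDissipationQuantum): a bounded
ancient mild solution `v` of Navier–Stokes (`ν = 1`, `IsBoundedAncientMildSolution 1 v`, KNSS duality
form) which is jointly smooth on `(−∞, 0) × ℝ³` and whose vorticity is everywhere parallel to ONE fixed
unit vector `e` (`curl (v t) x = c • e`) is spatially constant on every slice `t < 0`.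
(The registered bounded-gradient hypothesis is not needed and is not used.)

Proof (Giga–Miura 2011, proof of Thm 1.1 / Giga–Gu–Hsu 2019 §2.4, made rate-free; KNSS 2009, proof of
Thm 6.2 with Thm 5.1):
1. *Slice invariance along `e`* (tree: `stub_sliceInvariantOfCurlParallel`): each slice `v t` is `C²`,
   bounded, divergence free (weakly, hence pointwise by smoothness) with `curl (v t) ∥ e`, hence
   invariant under all translations along `ℝe`; in particular `D(v t)(x) e = 0`.
2. *The `e`-component is constant*: from `curl (v t) x = c • e` and `D(v t)(x) e = 0`, the linear
   algebra identity `⟪D a, e⟫ = ⟪D e, a⟫ + ⟪curl, a × e⟫` (in coordinates) gives `⟪D(v t)(x) a, e⟫ = 0`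
   for every `a`, so `x ↦ ⟪v t x, e⟫` has zero derivative (`inner_fderiv_eq_zero_of_curl_parallel`).
3. *The `e^⊥`-components are constant*: `v` is a bounded weak solution on `ℝ³ × (−∞,0)`
   (`IsBoundedAncientMildSolution.isBoundedWeakNSSolutionOn`); conjugating by a linear isometry `R`
   with `R e = e₁` (Householder, `Submodule.reflection_sub`; `IsBoundedWeakNSSolutionOn.conj_linearIsometryEquiv`)
   gives a bounded weak solution `W` invariant along the Lean coordinate `1`, whose planar trace is a
   bounded weak solution on `ℝ² × (−∞,0)` (`IsBoundedWeakNSSolutionOn.planarTrace_of_lineInvariant`),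
   hence slice-wise a.e. constant by the PROVED planar Liouville theorem of KNSS
   (`KNSS2009_liouville_planar_holds`, Thm 5.1) and everywhere constant by continuity
   (`planar_const_of_ae_const`).
4. Undo the rotation.

References: Y. Giga, H. Miura, Commun. Math. Phys. 303 (2011) 289–300, Thm 1.1; Y. Giga, Z. Gu,
P.-Y. Hsu, Nonlinear Anal. 189 (2019) 111579, §2.4; G. Koch, N. Nadirashvili, G. Seregin, V. Šverák,
Acta Math. 203 (2009) 83–105, Thm 5.1 and proof of Thm 6.2.
-/

noncomputable section

-- the summit and its single sub-problem share the name (CONVENTIONS §1), as in every Theorems file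
set_option linter.dupNamespace false

open Set Function Filter MeasureTheory WithLp
open scoped RealInnerProductSpace Topology

namespace Summit.NavierStokesRegularity.NavierStokesRegularity.Theorems

open Literature.Analysis Literature.Analysis.FluidPDE

/-! ### Linear algebra of the curl -/

/-- **The `e`-row of the Jacobian vanishes when the `e`-column does and the curl is parallel to `e`.**
For `w : ℝ³ → ℝ³`, if `curl w x = c • e` and `D w(x) e = 0` then `⟪D w(x) a, e⟫ = 0` for every `a`:
in coordinates `Σᵢ Dⱼᵢ eᵢ = Σᵢ Dᵢⱼ eᵢ + Σᵢ (Dⱼᵢ − Dᵢⱼ) eᵢ`, the first sum is the `j`-th component of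
`D e = 0` and the second is `c (e × e)ⱼ = 0`. (No differentiability is needed: `curl` and `fderiv`
share the junk value `0`.) [folklore] -/
theorem inner_fderiv_eq_zero_of_curl_parallel {w : (EuclideanSpace ℝ (Fin 3)) → (EuclideanSpace ℝ (Fin 3))} {x e : (EuclideanSpace ℝ (Fin 3))} {c : ℝ}
    (hcurl : curl w x = c • e) (he : fderiv ℝ w x e = 0) (a : (EuclideanSpace ℝ (Fin 3))) :
    ⟪fderiv ℝ w x a, e⟫ = 0 := by
  set D : (EuclideanSpace ℝ (Fin 3)) →L[ℝ] (EuclideanSpace ℝ (Fin 3)) := fderiv ℝ w x with hD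
  -- expansions of `a` and `e` in the standard basis
  have hexp : ∀ z : (EuclideanSpace ℝ (Fin 3)), D z = ∑ j : Fin 3, z j • D (EuclideanSpace.single j (1 : ℝ)) := by
    intro z
    conv_lhs => rw [← (EuclideanSpace.basisFun (Fin 3) ℝ).sum_repr z]
    simp [map_sum, map_smul]
  -- the three curl equations and the three components of `D e = 0`
  have hc0 := congrArg (fun v : (EuclideanSpace ℝ (Fin 3)) => v 0) hcurl
  have hc1 := congrArg (fun v : (EuclideanSpace ℝ (Fin 3)) => v 1) hcurl
  have hc2 := congrArg (fun v : (EuclideanSpace ℝ (Fin 3)) => v 2) hcurl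
  have he' : ∑ j : Fin 3, e j • D (EuclideanSpace.single j (1 : ℝ)) = 0 := by rw [← hexp e]; exact he
  have he0 := congrArg (fun v : (EuclideanSpace ℝ (Fin 3)) => v 0) he'
  have he1 := congrArg (fun v : (EuclideanSpace ℝ (Fin 3)) => v 1) he'
  have he2 := congrArg (fun v : (EuclideanSpace ℝ (Fin 3)) => v 2) he'
  simp only [curl, PiLp.toLp_apply, Matrix.cons_val_zero, Matrix.cons_val_one, Matrix.cons_val_two,
    Matrix.head_cons, Matrix.tail_cons, PiLp.smul_apply, smul_eq_mul] at hc0 hc1 hc2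
  simp only [Fin.sum_univ_three, PiLp.add_apply, PiLp.smul_apply, smul_eq_mul, PiLp.zero_apply]
    at he0 he1 he2
  rw [hexp a]
  simp only [Fin.sum_univ_three, PiLp.inner_apply, PiLp.add_apply, PiLp.smul_apply, smul_eq_mul,
    RCLike.inner_apply, conj_trivial]
  -- now a polynomial identity in the nine entries `D (single j 1) i`
  linear_combination a 0 * he0 + a 1 * he1 + a 2 * he2
    + (a 1 * e 2 - a 2 * e 1) * hc0 + (a 2 * e 0 - a 0 * e 2) * hc1 + (a 0 * e 1 - a 1 * e 0) * hc2

/-- **A linear isometry of `ℝ³` taking the unit vector `e` to `e₁ = EuclideanSpace.single 1 1`**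
(the Householder reflection in the hyperplane orthogonal to `e − e₁`, Mathlib
`Submodule.reflection_sub`). [folklore] -/
theorem exists_linearIsometryEquiv_map_eq_single_one {e : (EuclideanSpace ℝ (Fin 3))} (he : ‖e‖ = 1) :
    ∃ R : (EuclideanSpace ℝ (Fin 3)) ≃ₗᵢ[ℝ] (EuclideanSpace ℝ (Fin 3)), R e = EuclideanSpace.single 1 (1 : ℝ) := by
  have hn : ‖e‖ = ‖(EuclideanSpace.single (1 : Fin 3) (1 : ℝ) : (EuclideanSpace ℝ (Fin 3)))‖ := by simp [he]
  exact ⟨_, Submodule.reflection_sub hn⟩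

/-! ### The Liouville theorem -/

/-- **Stub `stub_unidirectionalLiouville` (crux stmt-NavierStokesRegularity-18584, lines `birth`/`pace`;
verbatim the shared item stmt-NavierStokesRegularity-1923) — the rate-free unidirectional Liouville
theorem.** A bounded ancient mild solution `v` of Navier–Stokes (`ν = 1`) on `ℝ³ × (−∞, 0)`, jointly
smooth, whose vorticity is everywhere parallel to one fixed unit vector `e`, is spatially constant on
every slice `t < 0`. (The bounded-gradient hypothesis of the registered signature is not used.)

Proof: (1) each slice is invariant under the translations along `ℝe` (`stub_sliceInvariantOfCurlParallel`:
the `e`-increment is bounded, divergence free and irrotational), so `D(v t) e = 0`; (2) with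
`curl (v t) = c e` this forces `⟪D(v t) a, e⟫ = 0` for all `a` (`inner_fderiv_eq_zero_of_curl_parallel`),
so the `e`-component `⟪v t ·, e⟫` is constant; (3) `v` is a bounded weak solution
(`IsBoundedAncientMildSolution.isBoundedWeakNSSolutionOn`), its conjugate `W = R v R⁻¹` by a linear
isometry with `R e = e₁` is a bounded weak solution invariant along the coordinate `1`
(`IsBoundedWeakNSSolutionOn.conj_linearIsometryEquiv`), whose planar trace is a bounded weak solution
on `ℝ² × (−∞,0)` (`IsBoundedWeakNSSolutionOn.planarTrace_of_lineInvariant`) and hence slice-wise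
constant by KNSS 2009 Thm 5.1 (`KNSS2009_liouville_planar_holds`, PROVED in tree) and continuity
(`planar_const_of_ae_const`); (4) undo the rotation. (Giga–Miura 2011, proof of Thm 1.1, without the
Type I rate; KNSS 2009, proof of Thm 6.2 with Thm 5.1.) [cite: GigaMiura2011, Thm 1.1 (Commun. Math. Phys. 303 (2011) 289–300)] -/
theorem stub_unidirectionalLiouville : ∀ (v : ℝ → EuclideanSpace ℝ (Fin 3) → EuclideanSpace ℝ (Fin 3)) (e : EuclideanSpace ℝ (Fin 3)), ‖e‖ = 1 → Literature.Analysis.FluidPDE.IsBoundedAncientMildSolution 1 v → ContDiffOn ℝ (⊤ : ℕ∞) (Function.uncurry v) (Set.Iio 0 ×ˢ Set.univ) → (∃ C : ℝ, ∀ t < 0, ∀ x, ‖fderiv ℝ (v t) x‖ ≤ C) → (∀ t < 0, ∀ x, ∃ c : ℝ, Literature.Analysis.FluidPDE.curl (v t) x = c • e) → ∀ t < 0, ∀ x y, v t x = v t y := by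
  intro v e he hv hsm _hgrad hdir
  have he0 : e ≠ 0 := by
    intro h; rw [h, norm_zero] at he; exact zero_ne_one he
  -- smooth slices, continuity on the slab, the bound, divergence-free slices
  have hst : IsSmoothSpaceTimeOn (Iio 0) v := hsm
  have hslice : ∀ t < 0, ContDiff ℝ (⊤ : ℕ∞) (v t) := fun t ht => hst.contDiff_slice ht
  have hC2 : ∀ t < 0, ContDiff ℝ 2 (v t) := fun t ht =>
    (hslice t ht).of_le (WithTop.coe_le_coe.mpr le_top)
  have hcont : ContinuousOn (uncurry v) (Iio 0 ×ˢ univ) := hsm.continuousOn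
  have hvc : ∀ t < 0, Continuous (v t) := fun t ht => (hslice t ht).continuous
  have hdiffv : ∀ t < 0, Differentiable ℝ (v t) := fun t ht =>
    (hslice t ht).differentiable (by simp)
  obtain ⟨M, hM⟩ := hv.isBoundedOn
  have hwdiv : ∀ t < 0, IsWeaklyDivFree (v t) := fun t ht => hv.isAncientMildSolution.1 t ht
  have hdiv : ∀ t < 0, VectorCalculus.IsDivFree (v t) := fun t ht =>
    (hwdiv t ht).isDivFree_of_contDiff ((hslice t ht).of_le (by exact_mod_cast le_top))
  -- Step 1: slice invariance along `e`, hence `D(v t)(x) e = 0`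
  have hinv : ∀ t < 0, ∀ (x : (EuclideanSpace ℝ (Fin 3))) (h : ℝ), v t (x + h • e) = v t x := fun t ht x h =>
    stub_sliceInvariantOfCurlParallel (v t) (hC2 t ht) (hdiv t ht) ⟨M, hM t ht⟩ e he0 (hdir t ht) x h
  have hDe : ∀ t < 0, ∀ x : (EuclideanSpace ℝ (Fin 3)), fderiv ℝ (v t) x e = 0 := by
    intro t ht x
    have hline : HasDerivAt (fun h : ℝ => x + h • e) e 0 := by
      simpa using ((hasDerivAt_id (0 : ℝ)).smul_const e).const_add x
    have hd : DifferentiableAt ℝ (v t) (x + (0 : ℝ) • e) := (hdiffv t ht).differentiableAt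
    have h1 : HasDerivAt (fun h : ℝ => v t (x + h • e)) (fderiv ℝ (v t) (x + (0 : ℝ) • e) e) 0 :=
      hd.hasFDerivAt.comp_hasDerivAt (0 : ℝ) hline
    simp only [zero_smul, add_zero] at h1
    have h2 : HasDerivAt (fun h : ℝ => v t (x + h • e)) 0 0 := by
      have hc : (fun h : ℝ => v t (x + h • e)) = fun _ => v t x := funext fun h => hinv t ht x h
      rw [hc]; exact hasDerivAt_const 0 _
    exact h1.unique h2
  -- Step 2: the `e`-component is constant on every slice
  have hecomp : ∀ t < 0, ∀ x : (EuclideanSpace ℝ (Fin 3)), ⟪v t x, e⟫ = ⟪v t 0, e⟫ := by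
    intro t ht
    have hg : Differentiable ℝ (fun x => ⟪v t x, e⟫) := (hdiffv t ht).inner ℝ (differentiable_const e)
    have hg0 : ∀ x, fderiv ℝ (fun x => ⟪v t x, e⟫) x = 0 := by
      intro x
      obtain ⟨c, hc⟩ := hdir t ht x
      ext a
      rw [fderiv_inner_apply ℝ (hdiffv t ht x) (differentiableAt_const e)]
      simp only [fderiv_fun_const, Pi.zero_apply, zero_apply, inner_zero_right,
        zero_add]
      exact inner_fderiv_eq_zero_of_curl_parallel hc (hDe t ht x) a
    intro x
    exact is_const_of_fderiv_eq_zero hg hg0 x 0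
  -- Step 3: weak solution, rotate `e` to `e₁`, descend to the plane, KNSS Thm 5.1
  have hmeas : AEStronglyMeasurable (uncurry v)
      ((volume : Measure (ℝ × (EuclideanSpace ℝ (Fin 3)))).restrict (Iio 0 ×ˢ univ)) :=
    hcont.aestronglyMeasurable (measurableSet_Iio.prod MeasurableSet.univ)
  have hweak : IsBoundedWeakNSSolutionOn (Iio 0) isOpen_Iio 1 v :=
    hv.isBoundedWeakNSSolutionOn one_pos hmeas fun t ht => (hvc t ht).aestronglyMeasurable
  obtain ⟨R, hR⟩ := exists_linearIsometryEquiv_map_eq_single_one he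
  set W : ℝ → (EuclideanSpace ℝ (Fin 3)) → (EuclideanSpace ℝ (Fin 3)) := fun t y => R (v t (R.symm y)) with hWdef
  have hW : IsBoundedWeakNSSolutionOn (Iio 0) isOpen_Iio 1 W := hweak.conj_linearIsometryEquiv R
  have hWcont : ContinuousOn (uncurry W) (Iio 0 ×ˢ univ) := by
    have h1 : ContinuousOn (fun p : ℝ × (EuclideanSpace ℝ (Fin 3)) => uncurry v (p.1, R.symm p.2)) (Iio 0 ×ˢ univ) :=
      hcont.comp (continuous_fst.prodMk (R.symm.continuous.comp continuous_snd)).continuousOn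
        fun p hp => ⟨hp.1, mem_univ _⟩
    exact R.continuous.comp_continuousOn h1
  have hpull : ∀ δ : ℝ, R.symm (EuclideanSpace.single 1 δ) = δ • e := by
    intro δ
    have e1 : R (δ • e) = EuclideanSpace.single (1 : Fin 3) δ := by
      rw [LinearIsometryEquiv.map_smul, hR]
      ext i
      by_cases hi : i = 1
      · subst hi; simp
      · simp [hi]
    rw [← e1, LinearIsometryEquiv.symm_apply_apply]
  have hWinv : ∀ t < 0, ∀ (y : (EuclideanSpace ℝ (Fin 3))) (δ : ℝ), W t (y + EuclideanSpace.single 1 δ) = W t y := by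
    intro t ht y δ
    simp only [hWdef, map_add, hpull]
    rw [hinv t ht]
  have hWdiv : ∀ t ∈ Iio 0, IsWeaklyDivFree (W t) := fun t ht =>
    (hwdiv t ht).conj_linearIsometryEquiv R
  have hV := hW.planarTrace_of_lineInvariant hWcont (fun t ht => hWinv t ht) hWdiv
  obtain ⟨b, -, -, hae⟩ := KNSS2009_liouville_planar_holds hV
  have hplanar := planar_const_of_ae_const hWcont hWinv hae
  -- Step 4: assemble and undo the rotation
  intro t ht x y
  have hcomp1 : ∀ z : (EuclideanSpace ℝ (Fin 3)), W t z 1 = ⟪v t (R.symm z), e⟫ := by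
    intro z
    have h1 : W t z 1 = ⟪W t z, EuclideanSpace.single (1 : Fin 3) (1 : ℝ)⟫ := by
      simp [EuclideanSpace.inner_single_right]
    rw [h1, ← hR]
    exact R.inner_map_map _ _
  have hWeq : W t (R x) = W t (R y) := by
    have h0 := (hplanar t ht (R x)).1.trans (hplanar t ht (R y)).1.symm
    have h2 := (hplanar t ht (R x)).2.trans (hplanar t ht (R y)).2.symm
    have h1 : W t (R x) 1 = W t (R y) 1 := by
      rw [hcomp1, hcomp1, hecomp t ht (R.symm (R x)), hecomp t ht (R.symm (R y))]
    ext i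
    fin_cases i
    · exact h0
    · exact h1
    · exact h2
  have hR' : R (v t x) = R (v t y) := by simpa [hWdef] using hWeq
  exact R.injective hR'

end Summit.NavierStokesRegularity.NavierStokesRegularity.Theorems

end
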